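import Mathlib

/-!
# Sketch — orbit-pair-table checker (crux idea on stmt-Ventures-22024, hub-lb-idea-1 g3)

First checkable statement of the line: if the normal-form map `nf` on word pairs is
equivariant under a finite group `G` acting on words (and on normal forms), then every
pair product `(g • u, h • v)` is obtained from the ORBIT-PAIR TABLE entry `(u, (g⁻¹ * h) • v)`
by acting with `g` — so a checker normal-orders `|G|` products per orbit-representative pair
instead of `|G|²`, i.e. the total normal-ordering work drops by the factor `|G|`.
The second statement is the block-entry assembly: a `G`-invariant functional `φ` sees only
the table.
-/

namespace Summit.Ventures.CertifiedManyBodySolver.Cruxes.LowerEdge_ge_m83o100.OrbitPairTable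

variable {G W M : Type*} [Group G] [MulAction G W]

/-- Pair products reduce to the orbit-pair table by equivariance of the normal form. -/
theorem nf_pair_eq_act_table (nf : W → W → M) (act : G → M → M)
    (hequiv : ∀ (g : G) (u v : W), nf (g • u) (g • v) = act g (nf u v))
    (u v : W) (g h : G) :
    nf (g • u) (h • v) = act g (nf u ((g⁻¹ * h) • v)) := by
  have hv : h • v = g • ((g⁻¹ * h) • v) := by
    rw [smul_smul, mul_inv_cancel_left]
  rw [hv]
  exact hequiv g u _

/-- A `G`-invariant functional evaluated on any pair product equals its value on the
orbit-pair table entry: the identity check needs `φ ∘ nf` only on `(u, k • v)`, `k : G`. -/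
theorem invariant_functional_on_pairs [AddCommMonoid M] (nf : W → W → M) (act : G → M → M)
    (hequiv : ∀ (g : G) (u v : W), nf (g • u) (g • v) = act g (nf u v))
    (φ : M →+ ℝ) (hφ : ∀ (g : G) (m : M), φ (act g m) = φ m)
    (u v : W) (g h : G) :
    φ (nf (g • u) (h • v)) = φ (nf u ((g⁻¹ * h) • v)) := by
  rw [nf_pair_eq_act_table nf act hequiv u v g h, hφ]

/-- Counting form of the lever: over a finite group, the family of all pair products
`(g • u, h • v)`, `g h : G`, takes at most `|G|` distinct table entries after `φ`. -/
theorem pair_values_factor_through_table [Fintype G] [DecidableEq G] [AddCommMonoid M]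
    (nf : W → W → M) (act : G → M → M)
    (hequiv : ∀ (g : G) (u v : W), nf (g • u) (g • v) = act g (nf u v))
    (φ : M →+ ℝ) (hφ : ∀ (g : G) (m : M), φ (act g m) = φ m) (u v : W) :
    (Finset.univ.image fun p : G × G => φ (nf (p.1 • u) (p.2 • v))) ⊆
      Finset.univ.image fun k : G => φ (nf u (k • v)) := by
  classical
  intro x hx
  simp only [Finset.mem_image, Finset.mem_univ, true_and] at hx ⊢
  obtain ⟨p, rfl⟩ := hx
  exact ⟨p.1⁻¹ * p.2, (invariant_functional_on_pairs nf act hequiv φ hφ u v p.1 p.2).symm⟩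

end Summit.Ventures.CertifiedManyBodySolver.Cruxes.LowerEdge_ge_m83o100.OrbitPairTable
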